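import Mathlib
import Summits.NavierStokesRegularity.NavierStokesRegularity.Theorems.SubOnsagerCeilingOrthantTailCeiling.Negative.OrthantTailCeilingFalseOfSideBranchCriticalEscapeEstimate
import Summits.NavierStokesRegularity.NavierStokesRegularity.Theorems.SubcriticalEnvelopeForwardSourceTailEnvelopeKPDyadicRatioTwo
import HarnessLib

/-!
# The line «shell-barrier» of `SubOnsagerCeiling.OrthantTailCeiling` (stmt-NavierStokesRegularity-25507)
# dies at `α_SB` modulo the ONSAGER-CRITICAL escape estimate

Corollaries of the negative lemma
`Theorems/SubOnsagerCeilingOrthantTailCeiling/Negative/OrthantTailCeilingFalseOfSideBranchCriticalEscapeEstimate.lean`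
(`not_ceilingAt_sideBranch_of_criticalEscapeEstimate`: the per-table tail ceiling at the side-branch
dead-end table `α_SB` fails modulo `SideBranchCriticalEscapeEstimateAt ε₀` — the block `0..K` loses
only the Onsager-critical amount `c·(1+ε₀)^{-K}·E₀`, at infinitely many depths, depth-dependent
horizon) for the registered skeleton «shell-barrier» (Cruxes/OrthantTailCeiling/Lines/shell_barrier.lean,
stubs `Sig.stub_barrierLargeRatio`, `Sig.stub_barrierSmallRatio` of `Theorems/SubOnsagerCeilingDefs.lean`):
a `ν`-uniform weighted per-shell bound `(1+ε₀)^{2θk}·½X_{i,k}² ≤ D·E₀` is a tail ceiling by the glue of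
record `subOnsagerCeiling_ceilingAt_of_shellBarrierAt` (geometric series, `θ > 1/2`), so

* `not_shellBarrierAt_sideBranch_of_criticalEscapeEstimate :
    SideBranchCriticalEscapeEstimateAt ε₀ → ¬ ShellBarrierAt 10 ε₀ sideBranchTable`,
* `stub_barrierLargeRatio_false_of_sideBranchCriticalEscapeEstimate` (`ε₀ ∈ (1/4,1]`),
* `stub_barrierSmallRatio_false_of_sideBranchCriticalEscapeEstimate` (`ε₀ ∈ (0,1/4]`).

These supersede the `SideBranchEscape` versions of p620932 (fixed fraction, fixed horizon, all depths).

HONEST FRAMING: MODEL lattice ODEs only (Tao 2016 §4 vocabulary; rung TL-M2Break); conditional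
refutations of a line already declared dead by its lead; they settle nothing by themselves; no summit,
rung or crux is proved; nothing here is a statement about the Navier–Stokes equations.
[cite: Tao2016AveragedNS, §4 (4.5), (4.8)]
-/

noncomputable section

-- the sub-problem namespace `NavierStokesRegularity.NavierStokesRegularity` is the tree's layout (D-0017)
set_option linter.dupNamespace false

namespace Summit.NavierStokesRegularity.NavierStokesRegularity.Theorems.SubOnsagerCeiling

open Summit.NavierStokesRegularity.NavierStokesRegularity.Theses.SubOnsagerCeiling

/-- **The shell barrier of the line «shell-barrier» fails at `α_SB` modulo the Onsager-critical
escape estimate**: a `ν`-uniform weighted per-shell bound is a tail ceiling (glue of record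
`subOnsagerCeiling_ceilingAt_of_shellBarrierAt`, geometric series, `θ > 1/2`). [this file] -/
theorem not_shellBarrierAt_sideBranch_of_criticalEscapeEstimate {ε₀ : ℝ} (hε : 0 < ε₀)
    (hH : SideBranchCriticalEscapeEstimateAt ε₀) : ¬ ShellBarrierAt 10 ε₀ sideBranchTable :=
  fun hSB => not_ceilingAt_sideBranch_of_criticalEscapeEstimate hε hH
    (subOnsagerCeiling_ceilingAt_of_shellBarrierAt hε hSB)

/-- The registered stub `Sig.stub_barrierLargeRatio` of the line «shell-barrier» is false modulo the
Onsager-critical escape estimate at any ratio `ε₀ ∈ (1/4, 1]`. [this file] -/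
theorem stub_barrierLargeRatio_false_of_sideBranchCriticalEscapeEstimate
    (hH : ∃ ε₀ : ℝ, 1 / 4 < ε₀ ∧ ε₀ ≤ 1 ∧ SideBranchCriticalEscapeEstimateAt ε₀) :
    ¬ Sig.stub_barrierLargeRatio := by
  obtain ⟨ε₀, hε, hε1, hHε⟩ := hH
  intro hstub
  exact not_shellBarrierAt_sideBranch_of_criticalEscapeEstimate (by linarith) hHε
    (hstub 10 (by norm_num) ε₀ hε hε1 sideBranchTable)

/-- The registered stub `Sig.stub_barrierSmallRatio` of the line «shell-barrier» is false modulo the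
Onsager-critical escape estimate at any ratio `ε₀ ∈ (0, 1/4]`. [this file] -/
theorem stub_barrierSmallRatio_false_of_sideBranchCriticalEscapeEstimate
    (hH : ∃ ε₀ : ℝ, 0 < ε₀ ∧ ε₀ ≤ 1 / 4 ∧ SideBranchCriticalEscapeEstimateAt ε₀) :
    ¬ Sig.stub_barrierSmallRatio := by
  obtain ⟨ε₀, hε, hε1, hHε⟩ := hH
  intro hstub
  exact not_shellBarrierAt_sideBranch_of_criticalEscapeEstimate hε hHε
    (hstub 10 (by norm_num) ε₀ hε hε1 sideBranchTable)

end Summit.NavierStokesRegularity.NavierStokesRegularity.Theorems.SubOnsagerCeiling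

end
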